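import Mathlib
import Summits.Ventures.HodgeRepro2.Tier7.Line3.NumeratorNormDefinite

/-!
# Tier7/Line3/NumeratorIdealSize — the split row's size `N(I γ)·N(J γ)` against the archimedean size, as ONE theorem
(seat t7-x1, gen 5; the «(1,1)-places comparison of the sizes» of NumeratorNorm / NumeratorNormDefinite's [W] sentences)

LINE 3 (t7-plan-3), version (ii). SplitFactorProduct (p710177) bounds the split factor by `C² (N(I γ) N(J γ))^ε` with the
two numerator ideals `I γ = span {M κ(γ)}`, `J γ = span {M (κ(γ) − 1)}` (in words, `M` a common denominator), while the
dominance `size` of DominantSideOfKappa lives at the (1,1)-places, the definite places carrying `|κ|_w ≤ 1`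
(KappaDefiniteBound p666869). NumeratorNorm (p710707) / NumeratorNormDefinite (p711354) compare ONE numerator ideal with
the archimedean factors; this module composes the two ideals into ONE inequality over the model's `x = κ(γ)`:

* `apply_sub_one_le : w (x − 1) ≤ w x + 1` and hence `w (x − 1) ≤ 2` on the places where `w x ≤ 1` (`B = 2` for
  `κ − 1`, plan-3 STATUS l. 15998);
* `absNorm_span_mul_absNorm_span_le`: for `a = m x`, `b = m (x − 1)` in `𝓞 K` and a set `D` of places with `w x ≤ 1`,
  `N(span{a}) · N(span{b}) ≤ |N(m)|² · 6^{∑_{w ∈ D} mult w} · ∏_{w ∉ D} ((1 + w x)(1 + w (x − 1)))^{mult w}`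
  (the factor `6 = 2 · 3` per definite place: `(1 + 1)(1 + 2)`);
* `absNorm_span_mul_absNorm_span_le_of_isReal`: the totally real case (`∀ w, w.IsReal`, every `mult = 1`) with ONE
  definite place `w₀`: `≤ 6 |N(m)|² ∏_{w ≠ w₀} (1 + w x)(1 + w (x − 1))` — the split row's `size γ = N(I γ) N(J γ)` is
  at most `6 N(M)² (1 + |κ|_{ι₂})(1 + |κ|_{ι₃})(1 + |κ − 1|_{ι₂})(1 + |κ − 1|_{ι₃})`, the dominance `size` up to the
  constant `6 N(M)²` and the choice of how `size` is built from the (1,1)-factors (a rescaling of `ε` only, plan-3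
  STATUS l. 15989 (c)–(d)).

WHAT THIS CHANGES IN THE [W] COLUMN: «the (1,1)-places comparison of the sizes up to `2 |N(M)|`» (in words since
NumeratorNormDefinite) → a theorem over `x = κ(γ)` for BOTH ideals at once; the two displayed size functions of crit-2
STATUS l. 15974 (ii) are linked by a theorem, not a displayed inequality. STILL IN WORDS: `x = κ(γ)`, `m = M` a common
denominator of `κ₀` and the lattice (so that `a γ, b γ ∈ 𝓞 K` on the support), `D = {ι₁}` the definite place with
`|κ|_{ι₁} ≤ 1` (KappaDefiniteBound), `I γ = span{a γ}`, `J γ = span{b γ}` — the identification (a′). Nothing here is about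
(N), (P), the real `X`, or HC_CM; §8(d): NO. Blind lane: Mathlib + the HodgeRepro2 prefix; no sorry;
axioms ⊆ {propext, Classical.choice, Quot.sound}.
-/

namespace Summit.Ventures.HodgeRepro2.Tier7.Line3.NumeratorIdealSize

open NumberField Summit.Ventures.HodgeRepro2.Tier7.Line3.NumeratorNorm
open scoped NumberField

variable {K : Type*} [Field K] [NumberField K]

omit [NumberField K] in
/-- `w (x − 1) ≤ w x + 1` at every infinite place. -/
theorem apply_sub_one_le (w : InfinitePlace K) (x : K) : w (x - 1) ≤ w x + 1 := by
  have h := w.1.add_le x (-1)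
  rw [← sub_eq_add_neg, AbsoluteValue.map_neg, AbsoluteValue.map_one] at h
  exact h

omit [NumberField K] in
/-- on a place with `w x ≤ 1`, `w (x − 1) ≤ 2`. -/
theorem apply_sub_one_le_two (w : InfinitePlace K) (x : K) (hx : w x ≤ 1) : w (x - 1) ≤ 2 := by
  linarith [apply_sub_one_le w x]

open scoped Classical in
/-- **the two numerator ideals against the archimedean size, the definite places absorbed**: for `a = m x`,
`b = m (x − 1)` and `w x ≤ 1` on `D`,
`N(span{a}) · N(span{b}) ≤ |N(m)|² · 6^{∑_{w ∈ D} mult w} · ∏_{w ∉ D} ((1 + w x)(1 + w (x − 1)))^{mult w}`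
— NumeratorNormDefinite's `absNorm_span_le_of_le` at `(x, a, m, B = 1)` and at `(x − 1, b, m, B = 2)` multiplied, the
SAME `m` in both displayed equations (so `b = a − m`, a consequence, not a binder). Degenerate instances (crit-2 STATUS
l. 16095 (i)): `x = 0` (`a = 0`, `span {0} = ⊥`, `absNorm ⊥ = 0`), `x = 1` (`b = 0`), `m = 0` (`a = b = 0`, `|N(m)| = 0`)
read `0 ≤ …` or `0 ≤ 0`, consistent, no junk value (`absNorm` is `ℕ`-valued, the inequality is in `ℝ`); `D = ∅` is the
bare product of the two NumeratorNorm bounds; no non-zero hypothesis is needed (plan-3 l. 16094 (2)). At a complex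
place of `D` the exponent is `mult = 2` (constant `36` per such place). -/
theorem absNorm_span_mul_absNorm_span_le (x : K) (a b m : 𝓞 K) (ha : (a : K) = (m : K) * x)
    (hb : (b : K) = (m : K) * (x - 1)) (D : Finset (InfinitePlace K)) (hD : ∀ w ∈ D, w x ≤ 1) :
    (Ideal.absNorm (Ideal.span {a}) : ℝ) * (Ideal.absNorm (Ideal.span {b}) : ℝ) ≤
      ((|Algebra.norm ℚ (m : K)| : ℚ) : ℝ) ^ 2 * ((6 : ℝ) ^ (∑ w ∈ D, w.mult) *
        ∏ w ∈ Finset.univ \ D, ((1 + w x) * (1 + w (x - 1))) ^ w.mult) := by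
  have hA := absNorm_span_le_of_le x a m ha D hD
  have hB := absNorm_span_le_of_le (x - 1) b m hb D fun w hw => apply_sub_one_le_two w x (hD w hw)
  have h6 : (6 : ℝ) ^ (∑ w ∈ D, w.mult) = (1 + 1) ^ (∑ w ∈ D, w.mult) * (1 + 2) ^ (∑ w ∈ D, w.mult) := by
    rw [← mul_pow]; norm_num
  have hprod : ∏ w ∈ Finset.univ \ D, ((1 + w x) * (1 + w (x - 1))) ^ w.mult =
      (∏ w ∈ Finset.univ \ D, (1 + w x) ^ w.mult) * ∏ w ∈ Finset.univ \ D, (1 + w (x - 1)) ^ w.mult := by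
    rw [← Finset.prod_mul_distrib]
    exact Finset.prod_congr rfl fun w _ => mul_pow _ _ _
  have hnnA : 0 ≤ (Ideal.absNorm (Ideal.span {a}) : ℝ) := Nat.cast_nonneg _
  have hnnB : 0 ≤ ((|Algebra.norm ℚ (m : K)| : ℚ) : ℝ) * ((1 + 1) ^ (∑ w ∈ D, w.mult) *
      ∏ w ∈ Finset.univ \ D, (1 + w x) ^ w.mult) := by
    apply mul_nonneg (by positivity)
    apply mul_nonneg (by positivity)
    exact Finset.prod_nonneg fun w _ => pow_nonneg (by linarith [apply_nonneg w x]) _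
  calc (Ideal.absNorm (Ideal.span {a}) : ℝ) * (Ideal.absNorm (Ideal.span {b}) : ℝ)
      ≤ (((|Algebra.norm ℚ (m : K)| : ℚ) : ℝ) * ((1 + 1) ^ (∑ w ∈ D, w.mult) *
          ∏ w ∈ Finset.univ \ D, (1 + w x) ^ w.mult)) *
        (((|Algebra.norm ℚ (m : K)| : ℚ) : ℝ) * ((1 + 2) ^ (∑ w ∈ D, w.mult) *
          ∏ w ∈ Finset.univ \ D, (1 + w (x - 1)) ^ w.mult)) :=
        mul_le_mul hA hB (Nat.cast_nonneg _) hnnB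
    _ = ((|Algebra.norm ℚ (m : K)| : ℚ) : ℝ) ^ 2 * ((6 : ℝ) ^ (∑ w ∈ D, w.mult) *
        ∏ w ∈ Finset.univ \ D, ((1 + w x) * (1 + w (x - 1))) ^ w.mult) := by
        rw [h6, hprod]; ring

omit [NumberField K] in
/-- for a real place the multiplicity is `1`. -/
theorem mult_eq_one_of_isReal (w : InfinitePlace K) (hw : w.IsReal) : w.mult = 1 := by
  unfold InfinitePlace.mult
  rw [if_pos hw]

open scoped Classical in
/-- **the totally real case with ONE definite place `w₀`**: `N(span{a}) · N(span{b}) ≤ 6 |N(m)|² ∏_{w ≠ w₀} (1 + w x)(1 + w (x − 1))`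
— the split row's `size γ = N(I γ) N(J γ)` against the (1,1)-factors of the dominance `size`, up to `6 N(M)²`.
`hreal : ∀ w, w.IsReal` is a DISPLAYED hypothesis (`K = E⁺` totally real — dictionary (a′), in words; crit-2 STATUS
l. 16095 (ii)); `w₀ = ι₁` the one definite place of the seesaw datum — a datum with several definite places cites
`absNorm_span_mul_absNorm_span_le` with `D` the set of them (`6^{|D|}`; plan-3 l. 16094 (4)). -/
theorem absNorm_span_mul_absNorm_span_le_of_isReal (hreal : ∀ w : InfinitePlace K, w.IsReal) (x : K)
    (a b m : 𝓞 K) (ha : (a : K) = (m : K) * x) (hb : (b : K) = (m : K) * (x - 1)) (w₀ : InfinitePlace K)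
    (hw₀ : w₀ x ≤ 1) :
    (Ideal.absNorm (Ideal.span {a}) : ℝ) * (Ideal.absNorm (Ideal.span {b}) : ℝ) ≤
      6 * ((|Algebra.norm ℚ (m : K)| : ℚ) : ℝ) ^ 2 *
        ∏ w ∈ Finset.univ \ {w₀}, (1 + w x) * (1 + w (x - 1)) := by
  have h := absNorm_span_mul_absNorm_span_le x a b m ha hb {w₀} (by simpa using hw₀)
  have hsum : ∑ w ∈ ({w₀} : Finset (InfinitePlace K)), w.mult = 1 := by
    rw [Finset.sum_singleton, mult_eq_one_of_isReal w₀ (hreal w₀)]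
  have hprod : ∏ w ∈ Finset.univ \ {w₀}, ((1 + w x) * (1 + w (x - 1))) ^ w.mult =
      ∏ w ∈ Finset.univ \ {w₀}, (1 + w x) * (1 + w (x - 1)) :=
    Finset.prod_congr rfl fun w _ => by rw [mult_eq_one_of_isReal w (hreal w), pow_one]
  rw [hsum, hprod, pow_one] at h
  linarith [h]

omit [NumberField K] in
/-- `1 + w (x − 1) ≤ 2 (1 + w x)`: the `κ − 1` factor against the `κ` factor (crit-2 STATUS l. 16095 (iii)). -/
theorem one_add_apply_sub_one_le (w : InfinitePlace K) (x : K) : 1 + w (x - 1) ≤ 2 * (1 + w x) := by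
  linarith [apply_sub_one_le w x, apply_nonneg w x]

open scoped Classical in
/-- **against the TWO-factor size**: with `size := ∏_{w ≠ w₀} (1 + w x)` (the `κ`-factors alone),
`N(span{a}) · N(span{b}) ≤ 6 |N(m)|² · 2^{#(places ≠ w₀)} · size²` — the passage `1 + w (x − 1) ≤ 2 (1 + w x)`
that crit-2 STATUS l. 16095 (iii) asked for: the four-factor product is at most `2^{#} size²`, so against a dominance
`size` built from the `κ`-factors alone the split row's bound is `size^{2ε}` up to a constant — the «rescaling of ε»
(plan-3 STATUS l. 15989 (c)) is this squaring; against the four-factor product itself (plan-3 l. 16094 (3)) the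
exponent is unchanged. -/
theorem absNorm_span_mul_absNorm_span_le_sq (hreal : ∀ w : InfinitePlace K, w.IsReal) (x : K)
    (a b m : 𝓞 K) (ha : (a : K) = (m : K) * x) (hb : (b : K) = (m : K) * (x - 1)) (w₀ : InfinitePlace K)
    (hw₀ : w₀ x ≤ 1) :
    (Ideal.absNorm (Ideal.span {a}) : ℝ) * (Ideal.absNorm (Ideal.span {b}) : ℝ) ≤
      6 * ((|Algebra.norm ℚ (m : K)| : ℚ) : ℝ) ^ 2 *
        ((2 : ℝ) ^ (Finset.univ \ {w₀}).card * (∏ w ∈ Finset.univ \ {w₀}, (1 + w x)) ^ 2) := by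
  refine (absNorm_span_mul_absNorm_span_le_of_isReal hreal x a b m ha hb w₀ hw₀).trans ?_
  have hle : ∏ w ∈ Finset.univ \ {w₀}, (1 + w x) * (1 + w (x - 1)) ≤
      ∏ w ∈ Finset.univ \ {w₀}, (2 * (1 + w x) ^ 2) := by
    apply Finset.prod_le_prod
    · intro w _
      exact mul_nonneg (by linarith [apply_nonneg w x]) (by linarith [apply_nonneg w (x - 1)])
    · intro w _
      have h1 : 0 ≤ 1 + w x := by linarith [apply_nonneg w x]
      nlinarith [one_add_apply_sub_one_le w x, h1]
  have heq : ∏ w ∈ Finset.univ \ {w₀}, (2 * (1 + w x) ^ 2) =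
      (2 : ℝ) ^ (Finset.univ \ {w₀}).card * (∏ w ∈ Finset.univ \ {w₀}, (1 + w x)) ^ 2 := by
    rw [Finset.prod_mul_distrib, Finset.prod_const, Finset.prod_pow]
  rw [← heq]
  exact mul_le_mul_of_nonneg_left hle (by positivity)

open scoped Classical in
/-- **the `ε`-power** (the shape SplitFactorProduct consumes; crit-2 STATUS l. 16095 (iv)): for `0 ≤ ε`,
`(N(span{a}) · N(span{b}))^ε ≤ (6 |N(m)|² ∏_{w ≠ w₀} (1 + w x)(1 + w (x − 1)))^ε` — `Real.rpow` monotone on `[0, ∞)`. -/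
theorem absNorm_span_mul_absNorm_span_rpow_le (hreal : ∀ w : InfinitePlace K, w.IsReal) (x : K)
    (a b m : 𝓞 K) (ha : (a : K) = (m : K) * x) (hb : (b : K) = (m : K) * (x - 1)) (w₀ : InfinitePlace K)
    (hw₀ : w₀ x ≤ 1) {ε : ℝ} (hε : 0 ≤ ε) :
    ((Ideal.absNorm (Ideal.span {a}) : ℝ) * (Ideal.absNorm (Ideal.span {b}) : ℝ)) ^ ε ≤
      (6 * ((|Algebra.norm ℚ (m : K)| : ℚ) : ℝ) ^ 2 *
        ∏ w ∈ Finset.univ \ {w₀}, (1 + w x) * (1 + w (x - 1))) ^ ε :=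
  Real.rpow_le_rpow (by positivity) (absNorm_span_mul_absNorm_span_le_of_isReal hreal x a b m ha hb w₀ hw₀) hε

end Summit.Ventures.HodgeRepro2.Tier7.Line3.NumeratorIdealSize
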